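import Literature.AlgebraicGeometry.HodgeTheory.HardLefschetzProducts
import Literature.AlgebraicGeometry.Milne1999.LefschetzCentraliserBiproducts
import Literature.AlgebraicGeometry.Milne1999.LefschetzCentraliserPowers
import Literature.AlgebraicGeometry.Deligne1982.WeilTypeCMGeneralMemberIsogenyClass
import Literature.AlgebraicGeometry.HodgeTheory.DivisorLefschetzGroupCentreFiniteIntrinsic
import HarnessLib

/-!
# «`D = Σᵢ A₁ × ⋯ × Dᵢ × ⋯ × A_s` is an ample divisor on `A`» on the carriers: Milne's product divisor classes on `A × B`,
# `A^{r+1}` and `⨁ᵢ Aᵢ` ARE polarization classes (Milne 1999, Duke 96, §1 p. 643; Birkenhake–Lange §5.3)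

Family `hodge`, lane `lit-hodgefound` (Track 2 foundations library), layer `Literature/AlgebraicGeometry/Milne1999`,
namespace `Literature.AlgebraicGeometry.Milne1999`; prover seat `lit-hodgefound-p21` (generation 36, row g36-#1, second
file — the abelian-variety corollaries of `HodgeTheory/HardLefschetzProducts`).  THEOREMS ONLY (no definition, no named
fact, no instance; D-0026 net debt `0`).

Until now every product statement of the `Milne1999/` layer took a polarization class of `A × B` (resp. `A^{r+1}`,
`⨁ Aᵢ`) as a SEPARATE hypothesis `hpol : IsPolarizationClass (A.prod B).dim (A.prod B).X h` next to those of the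
factors, the docstrings recording that «the class `D` of Milne's "`D = Σᵢ A₁ × ⋯ × Dᵢ × ⋯ × A_s` is an ample divisor on
`A`" need not be known to be a polarization class of the tree» (`LefschetzGroupProductsRestriction`), and
`LefschetzCentraliserBiproducts.sumPolarizationClass_hypotheses` carried only the three consequences (`B¹`-membership,
`D^{dim} ≠ 0`, non-degeneracy of `Q_D` on `H¹`) by hand.  This file closes the gap: the product classes
`prodPolarizationClass`, `powPolarizationClass`, `sumPolarizationClass` of polarization classes ARE polarization classes
(`HodgeTheory.IsPolarizationClass`: rational, supported on a divisor, hard Lefschetz in the dimension of the product).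

## Source, VERBATIM

J. S. Milne, *Lefschetz classes on abelian varieties*, Duke Math. J. **96** (1999) 639–675 [Milne1999LefschetzClasses],
§1 p. 643 (held `paper:doi-10-1215-s0012-7094-99-09620-5` p0005 L14–L24): «Let `A = A₁ × ⋯ × A_s`. Then
`C(A) ⊂ C(A₁) × ⋯ × C(A_s)`, with equality holding if and only if `Hom(Aᵢ, Aⱼ) = 0` for all `i, j`, `i ≠ j`. Moreover,
if `Dᵢ` is an ample divisor on `Aᵢ`, `i = 1, …, s`, then `D = Σᵢ A₁ × ⋯ × A_{i-1} × Dᵢ × A_{i+1} × ⋯ × A_s` is an ample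
divisor on `A`, and the involution it defines on `C(A)` is the restriction of the product of the involutions on the
`C(Aᵢ)` defined by the `Dᵢ`.»  Ch. Birkenhake, H. Lange, *Complex Abelian Varieties* (1992) [LangeBirkenhake1992], §5.3
(products of polarized abelian varieties: `(A₁ × A₂, p₁^* L₁ ⊗ p₂^* L₂)` is a polarized abelian variety of type the
concatenation of the types).  The hard Lefschetz clause is André 1996 §1.3 / Looijenga–Lunts (1.1) (`M' ⊠ M''`), proved
on the carriers in `HodgeTheory/HardLefschetzProducts` (`IsPolarizationClass.tensor`).

RELATION TO THE SUMMITS SIDE (disclosed; Literature cannot import `Summits/`, D-0017): the binary clause has summit-side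
twins `Summit.HodgeConjecture.HodgeConjecture.Theorems.hasHardLefschetzProperty_boxSum` ∕ `isPolarizationClass_boxSum`
(cell `pub-hodge-ring2`, a hand-rolled `𝔰𝔩₂` lowering operator on the carriers) and the biproduct clause the twin
`Summit.HodgeConjecture.CorCM.AndreSplit.isPolarizationClass_sumPolarizationClass` (iterating the former along
`biproductSuccSplit`); the Literature layer's own route is `HodgeTheory/HardLefschetzProducts` (Looijenga–Lunts' `M' ⊠ M''`
through the tree's `kunnethEquiv`), on which those summit files can be re-based.

## WHAT IS PROVED (no hypothesis beyond the factors' classes; dimensions arbitrary, `0` allowed)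

* §1 `A × B`: **`isPolarizationClass_prodPolarizationClass`** — `pr_A^* h_A + pr_B^* h_B` is a polarization class of
  `A × B` (dimension `dim (A × B)`); `hasHardLefschetzProperty_prodPolarizationClass` (hard Lefschetz alone, from hard
  Lefschetz of the factors alone); `exists_isPolarizationClass_prod_eq_prodPolarizationClass`.
* §2 `A^{r+1}`: **`isPolarizationClass_powPolarizationClass`**, `hasHardLefschetzProperty_powPolarizationClass`
  (Milne's `D` on the power, `h^{(r+2)} = pr^* h^{(r+1)} + pr_A^* h`, by induction on `r`).
* §3 `⨁_{i<n+1} Aᵢ`: **`isPolarizationClass_sumPolarizationClass`** (`Σᵢ πᵢ^* hᵢ`; induction along the comparison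
  isogeny `⨁_{Fin (n+1)} A ≅ A 0 × ⨁_{Fin n} (A ∘ succ)`, `map_biproductSuccSplit_prodPolarizationClass`, and transport
  of polarization classes along isogenies `IsPolarizationClass.map_of_isIsogeny'`);
  `hasHardLefschetzProperty_sumPolarizationClass`; `exists_isPolarizationClass_biproduct_eq_sumPolarizationClass`.
* §4 The hand-carried consequences recovered from the structure: `sumPolarizationClass_hypotheses_of_isPolarizationClass`
  (the three hypotheses of `LefschetzCentraliserBiproducts` for polarization classes `hᵢ` of positive-dimensional `Aᵢ`),
  `prodPolarizationClass_hypotheses_of_isPolarizationClass`.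

## References

* [Milne1999LefschetzClasses] J. S. Milne, *Lefschetz classes on abelian varieties*, Duke Math. J. 96 (1999), §1 p. 643.
* [LangeBirkenhake1992] Ch. Birkenhake, H. Lange, *Complex Abelian Varieties* (1992), §5.3; Lemma 1.7.4.
* [Andre1996Motifs] Y. André, *Pour une théorie inconditionnelle des motifs*, Publ. Math. IHÉS 83 (1996), §1.3 (p. 12).
* [LooijengaLunts1997] E. Looijenga, V. A. Lunts, Invent. Math. 129 (1997), §1 (1.1) p. 4.
* [MumfordAV1970] D. Mumford, *Abelian Varieties* (1970), §19 (products, isogenies).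
* [vanGeemen1994HodgeAV] B. van Geemen, LNM 1594 (1994), 3.6 (isogenies induce isomorphisms on `H•(·, ℚ)`).
-/

noncomputable section

open CategoryTheory CategoryTheory.Limits
open Literature.AlgebraicTopology.SingularHomology
open Literature.AlgebraicGeometry.HodgeTheory
open Literature.AlgebraicGeometry.Motives
open Literature.AlgebraicGeometry.VanGeemen1994 (hodgeClassSpan)
open Literature.Geometry.Kaehler (lefschetzPow HasHardLefschetzProperty)

namespace Literature.AlgebraicGeometry.Milne1999

/-! ### §1 `A × B`: `pr_A^* h_A + pr_B^* h_B` is a polarization class -/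

section Prod

variable (A B : AbelianVariety ℂ)

/-- **Hard Lefschetz for Milne's product divisor class on `A × B`**: if `h_A`, `h_B` have the hard Lefschetz property in
dimensions `dim A`, `dim B`, then `D = pr_A^* h_A + pr_B^* h_B` has it in dimension `dim (A × B) = dim A + dim B`
(`HodgeTheory.hasHardLefschetzProperty_map_fst_add_map_snd`: the Künneth isomorphism is an isomorphism of
`𝔰𝔩₂`-modules). [cite: Milne1999LefschetzClasses, §1 p. 643] [cite: Andre1996Motifs, §1.3 (p. 12)]
[cite: LooijengaLunts1997, §1 (1.1) p. 4] -/
theorem hasHardLefschetzProperty_prodPolarizationClass {hA : complexBetti A.X 2} {hB : complexBetti B.X 2}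
    (hLA : HasHardLefschetzProperty hA A.dim) (hLB : HasHardLefschetzProperty hB B.dim) :
    HasHardLefschetzProperty (prodPolarizationClass A B hA hB) (A.prod B).dim := by
  rw [AbelianVariety.dim_prod]
  exact hasHardLefschetzProperty_map_fst_add_map_snd (AbelianVariety.isSmoothProjective_holds (A := A))
    (AbelianVariety.isSmoothProjective_holds (A := B)) hLA hLB

/-- **«If `Dᵢ` is an ample divisor on `Aᵢ`, then `D = D₁ × A₂ + A₁ × D₂` is an ample divisor on `A₁ × A₂`» on the
carriers: the product class `pr_A^* h_A + pr_B^* h_B` of two polarization classes is a polarization class of `A × B`**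
(rational, supported on a divisor, hard Lefschetz in dimension `dim (A × B)`; `HodgeTheory.IsPolarizationClass.tensor`).
[cite: Milne1999LefschetzClasses, §1 p. 643] [cite: LangeBirkenhake1992, §5.3] [cite: Andre1996Motifs, §1.3 (p. 12)] -/
theorem isPolarizationClass_prodPolarizationClass {hA : complexBetti A.X 2} {hB : complexBetti B.X 2}
    (hpA : IsPolarizationClass A.dim A.X hA) (hpB : IsPolarizationClass B.dim B.X hB) :
    IsPolarizationClass (A.prod B).dim (A.prod B).X (prodPolarizationClass A B hA hB) := by
  rw [AbelianVariety.dim_prod]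
  exact hpA.tensor (AbelianVariety.isSmoothProjective_holds (A := A)) (AbelianVariety.isSmoothProjective_holds (A := B))
    hpB

/-- **`A × B` carries a polarization class of Milne's product shape** `pr_A^* h_A + pr_B^* h_B` with `h_A`, `h_B`
polarization classes of the factors. [cite: Milne1999LefschetzClasses, §1 p. 643] [cite: LangeBirkenhake1992, §5.3] -/
theorem exists_isPolarizationClass_prod_eq_prodPolarizationClass :
    ∃ (hA : complexBetti A.X 2) (hB : complexBetti B.X 2), IsPolarizationClass A.dim A.X hA ∧
      IsPolarizationClass B.dim B.X hB ∧
        IsPolarizationClass (A.prod B).dim (A.prod B).X (prodPolarizationClass A B hA hB) := by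
  obtain ⟨hA, hpA⟩ := exists_isPolarizationClass (AbelianVariety.isSmoothProjective_holds (A := A))
  obtain ⟨hB, hpB⟩ := exists_isPolarizationClass (AbelianVariety.isSmoothProjective_holds (A := B))
  exact ⟨hA, hB, hpA, hpB, isPolarizationClass_prodPolarizationClass A B hpA hpB⟩

end Prod

/-! ### §2 `A^{r+1}`: `Σᵢ prᵢ^* h` is a polarization class -/

section Pow

variable (A : AbelianVariety ℂ)

/-- **Hard Lefschetz for Milne's divisor class `h^{(r+1)} = Σᵢ prᵢ^* h` on the power `A^{r+1}`** (dimension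
`dim A^{r+1}`), from hard Lefschetz of `h` in dimension `dim A`, by induction along `A^{r+2} = A^{r+1} × A`.
[cite: Milne1999LefschetzClasses, §1 p. 643] [cite: Andre1996Motifs, §1.3 (p. 12)] -/
theorem hasHardLefschetzProperty_powPolarizationClass {h : complexBetti A.X 2} (hL : HasHardLefschetzProperty h A.dim) :
    ∀ r : ℕ, HasHardLefschetzProperty (powPolarizationClass A h r) (A.powSucc r).dim
  | 0 => hL
  | r + 1 => by
    rw [powPolarizationClass_succ]
    exact hasHardLefschetzProperty_prodPolarizationClass _ _ (hasHardLefschetzProperty_powPolarizationClass hL r) hL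

/-- **«`D = Σᵢ A × ⋯ × Dᵢ × ⋯ × A` is an ample divisor on `A^r`» on the carriers: `h^{(r+1)} = Σᵢ prᵢ^* h` is a
polarization class of `A^{r+1}`** for every polarization class `h` of `A`. [cite: Milne1999LefschetzClasses, §1 p. 643]
[cite: LangeBirkenhake1992, §5.3] -/
theorem isPolarizationClass_powPolarizationClass {h : complexBetti A.X 2} (hp : IsPolarizationClass A.dim A.X h) :
    ∀ r : ℕ, IsPolarizationClass (A.powSucc r).dim (A.powSucc r).X (powPolarizationClass A h r)
  | 0 => hp
  | r + 1 => by
    rw [powPolarizationClass_succ]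
    exact isPolarizationClass_prodPolarizationClass _ _ (isPolarizationClass_powPolarizationClass hp r) hp

/-- Every power `A^{r+1}` carries a polarization class of Milne's shape `Σᵢ prᵢ^* h`, `h` a polarization class of `A`.
[cite: Milne1999LefschetzClasses, §1 p. 643] -/
theorem exists_isPolarizationClass_powSucc_eq_powPolarizationClass (r : ℕ) :
    ∃ h : complexBetti A.X 2, IsPolarizationClass A.dim A.X h ∧
      IsPolarizationClass (A.powSucc r).dim (A.powSucc r).X (powPolarizationClass A h r) := by
  obtain ⟨h, hp⟩ := exists_isPolarizationClass (AbelianVariety.isSmoothProjective_holds (A := A))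
  exact ⟨h, hp, isPolarizationClass_powPolarizationClass A hp r⟩

end Pow

/-! ### §3 `⨁ᵢ Aᵢ`: `Σᵢ πᵢ^* hᵢ` is a polarization class -/

section Sum

/-- **«`D = Σᵢ A₁ × ⋯ × A_{i-1} × Dᵢ × A_{i+1} × ⋯ × A_s` is an ample divisor on `A = A₁ × ⋯ × A_s`» on the carriers:
`Σᵢ πᵢ^* hᵢ` is a polarization class of the finite biproduct `⨁_{i<n+1} Aᵢ`** whenever every `hᵢ` is a polarization
class of `Aᵢ` — induction along the comparison isogeny `⨁_{Fin (n+1)} A ≅ A 0 × ⨁_{Fin n} (A ∘ succ)` (along which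
`Σᵢ πᵢ^* hᵢ` is the pull-back of `pr₁^* h₀ + pr₂^* Σᵢ πᵢ^* h_{i+1}`, `map_biproductSuccSplit_prodPolarizationClass`),
polarization classes pulling back along isogenies (`IsPolarizationClass.map_of_isIsogeny'`).
[cite: Milne1999LefschetzClasses, §1 p. 643] [cite: LangeBirkenhake1992, §5.3] [cite: MumfordAV1970, §19] -/
theorem isPolarizationClass_sumPolarizationClass : ∀ {n : ℕ} (A : Fin (n + 1) → AbelianVariety ℂ)
    (h : ∀ i, complexBetti (A i).X 2), (∀ i, IsPolarizationClass (A i).dim (A i).X (h i)) →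
    IsPolarizationClass (⨁ A).dim (⨁ A).X (sumPolarizationClass A h)
  | 0, A, h, hp => by
    rw [sumPolarizationClass_fin_one]
    exact (hp 0).map_of_isIsogeny' (isIsogeny_biproduct_π_fin_one A)
  | n + 1, A, h, hp => by
    have ih := isPolarizationClass_sumPolarizationClass (fun i : Fin (n + 1) => A i.succ) (fun i => h i.succ)
      fun i => hp _
    have H := (isPolarizationClass_prodPolarizationClass _ _ (hp 0) ih).map_of_isIsogeny' (isIsogeny_biproductSuccSplit A)
    rwa [map_biproductSuccSplit_prodPolarizationClass] at H

/-- Hard Lefschetz for `Σᵢ πᵢ^* hᵢ` on `⨁_{i<n+1} Aᵢ` in dimension `dim ⨁ Aᵢ`, from hard Lefschetz of the `hᵢ` alone.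
[cite: Milne1999LefschetzClasses, §1 p. 643] [cite: Andre1996Motifs, §1.3 (p. 12)] -/
theorem hasHardLefschetzProperty_sumPolarizationClass : ∀ {n : ℕ} (A : Fin (n + 1) → AbelianVariety ℂ)
    (h : ∀ i, complexBetti (A i).X 2), (∀ i, HasHardLefschetzProperty (h i) (A i).dim) →
    HasHardLefschetzProperty (sumPolarizationClass A h) (⨁ A).dim
  | 0, A, h, hL => by
    rw [sumPolarizationClass_fin_one, AbelianVariety.dim_eq_of_isIsogeny (isIsogeny_biproduct_π_fin_one A)]
    exact (hL 0).map_of_isIsogeny (isIsogeny_biproduct_π_fin_one A)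
  | n + 1, A, h, hL => by
    have ih := hasHardLefschetzProperty_sumPolarizationClass (fun i : Fin (n + 1) => A i.succ) (fun i => h i.succ)
      fun i => hL _
    have H := (hasHardLefschetzProperty_prodPolarizationClass _ _ (hL 0) ih).map_of_isIsogeny
      (isIsogeny_biproductSuccSplit A)
    rwa [map_biproductSuccSplit_prodPolarizationClass,
      ← AbelianVariety.dim_eq_of_isIsogeny (isIsogeny_biproductSuccSplit A)] at H

/-- Every finite biproduct `⨁_{i<n+1} Aᵢ` carries a polarization class of Milne's shape `Σᵢ πᵢ^* hᵢ`, the `hᵢ`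
polarization classes of the `Aᵢ`. [cite: Milne1999LefschetzClasses, §1 p. 643] -/
theorem exists_isPolarizationClass_biproduct_eq_sumPolarizationClass {n : ℕ} (A : Fin (n + 1) → AbelianVariety ℂ) :
    ∃ h : ∀ i, complexBetti (A i).X 2, (∀ i, IsPolarizationClass (A i).dim (A i).X (h i)) ∧
      IsPolarizationClass (⨁ A).dim (⨁ A).X (sumPolarizationClass A h) := by
  choose h hp using fun i => exists_isPolarizationClass (AbelianVariety.isSmoothProjective_holds (A := A i))
  exact ⟨h, hp, isPolarizationClass_sumPolarizationClass A h hp⟩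

end Sum

/-! ### §4 The hand-carried hypotheses of the `Milne1999/` product files, recovered from the structure -/

section Hypotheses

/-- **The three product hypotheses of `LefschetzCentraliserBiproducts` for polarization classes**: for polarization
classes `hᵢ` of positive-dimensional `Aᵢ`, Milne's `D = Σᵢ πᵢ^* hᵢ` lies in `B¹(⨁ A) ⊗ ℂ`, has `D^{dim ⨁ A} ≠ 0`, and
`Q_D` is non-degenerate on `H¹(⨁ A)` — now three properties OF THE POLARIZATION CLASS `D` (a rational class of
type `(1,1)`, `isOfHodgeType_of_mem_algebraicClasses_of_isSmoothProjective`; `D^{dim} ≠ 0` and non-degeneracy of `Q_D`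
from hard Lefschetz, `AbelianVariety.lefschetzPow_self_ne_zero_of_hasHardLefschetzProperty`,
`eq_zero_of_forall_polarizationPairingOne_eq_zero_of_hasHardLefschetzProperty`), no longer an induction by hand.
[cite: Milne1999LefschetzClasses, §1 p. 643] [cite: LangeBirkenhake1992, §5.3] [cite: VoisinHodgeI2002, Thm. 6.25] -/
theorem sumPolarizationClass_hypotheses_of_isPolarizationClass {n : ℕ} (A : Fin (n + 1) → AbelianVariety ℂ)
    (h : ∀ i, complexBetti (A i).X 2) (h0 : ∀ i, 0 < (A i).dim)
    (hp : ∀ i, IsPolarizationClass (A i).dim (A i).X (h i)) :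
    sumPolarizationClass A h ∈ hodgeClassSpan (⨁ A).dim (⨁ A).X 1 ∧
      lefschetzPow (sumPolarizationClass A h) ((⨁ A).dim - 1) 2 (sumPolarizationClass A h) ≠ 0 ∧
      ∀ x : complexBetti (⨁ A).X 1,
        (∀ y, polarizationPairingOne (⨁ A).X (sumPolarizationClass A h) ((⨁ A).dim - 1) x y = 0) → x = 0 := by
  have hD := isPolarizationClass_sumPolarizationClass A h hp
  have hpos : 1 ≤ (⨁ A).dim := dim_biproduct_pos A (h0 0)
  exact ⟨Submodule.subset_span ⟨hD.isRationalClass, isOfHodgeType_of_mem_algebraicClasses_of_isSmoothProjective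
      (AbelianVariety.isSmoothProjective_holds (A := ⨁ A)) 1 hD.mem_algebraicClasses⟩,
    AbelianVariety.lefschetzPow_self_ne_zero_of_hasHardLefschetzProperty hpos hD.hasHardLefschetz,
    fun x hx => eq_zero_of_forall_polarizationPairingOne_eq_zero_of_hasHardLefschetzProperty hpos hD.hasHardLefschetz hx⟩

/-- The binary form: for polarization classes `h_A`, `h_B` of `A`, `B` with `dim A > 0`, the product class
`D = pr_A^* h_A + pr_B^* h_B` lies in `B¹(A × B) ⊗ ℂ`, has `D^{dim (A × B)} ≠ 0` and a non-degenerate `Q_D` on `H¹(A × B)`.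
[cite: Milne1999LefschetzClasses, §1 p. 643] [cite: LangeBirkenhake1992, §5.3] -/
theorem prodPolarizationClass_hypotheses_of_isPolarizationClass (A B : AbelianVariety ℂ) {hA : complexBetti A.X 2}
    {hB : complexBetti B.X 2} (hA0 : 0 < A.dim) (hpA : IsPolarizationClass A.dim A.X hA)
    (hpB : IsPolarizationClass B.dim B.X hB) :
    prodPolarizationClass A B hA hB ∈ hodgeClassSpan (A.prod B).dim (A.prod B).X 1 ∧
      lefschetzPow (prodPolarizationClass A B hA hB) ((A.prod B).dim - 1) 2 (prodPolarizationClass A B hA hB) ≠ 0 ∧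
      ∀ x : complexBetti (A.prod B).X 1,
        (∀ y, polarizationPairingOne (A.prod B).X (prodPolarizationClass A B hA hB) ((A.prod B).dim - 1) x y = 0) →
          x = 0 := by
  have hD := isPolarizationClass_prodPolarizationClass A B hpA hpB
  have hpos : 1 ≤ (A.prod B).dim := by rw [AbelianVariety.dim_prod]; omega
  exact ⟨Submodule.subset_span ⟨hD.isRationalClass, isOfHodgeType_of_mem_algebraicClasses_of_isSmoothProjective
      (AbelianVariety.isSmoothProjective_holds (A := A.prod B)) 1 hD.mem_algebraicClasses⟩,
    AbelianVariety.lefschetzPow_self_ne_zero_of_hasHardLefschetzProperty hpos hD.hasHardLefschetz,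
    fun x hx => eq_zero_of_forall_polarizationPairingOne_eq_zero_of_hasHardLefschetzProperty hpos hD.hasHardLefschetz hx⟩

end Hypotheses

end Literature.AlgebraicGeometry.Milne1999

end
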